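import Literature.MathematicalPhysics.QuantumFieldTheory.Balaban1983to89.B3AttachCounterterm
import Literature.MathematicalPhysics.QuantumFieldTheory.Balaban1983to89.B3Sect1Graphs122

/-!
# `Balaban1983to89.B3AttachCountertermDegree` — T. Bałaban, *(Higgs)₂,₃ quantum fields in a finite volume. III. Renormalization*,
Commun. Math. Phys. **88** (1983) 411–445 [Balaban1983Higgs3]: p. 423, the sentence after (2.3) — *"Thus the degree of G is the
same as the degree of a graph G′ obtained from G by attaching the corresponding graphs to the mass renormalization vertices"* —
PROVED on the concrete model `B3Cor23Concrete` for the surgery `B3AttachCounterterm.AttachData.attach`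

statement-level skeleton of published theorems with citation tags; proofs where landed; nothing here is a claim about the Yang–Mills mass gap

PDF held: `paper:balaban1983-higgs-2-3-quantum-fields-finite-volume` (journal page = PDF page + 410); renders read as images:
`…/b2b-balaban-ref1/pages/1983-cmp88-higgs23-III/1983-cmp88-higgs23-III-p006, p007, p012, p013-x2.png` (pp. 416, 417, 422, 423).
CITATION HEADER (lean-in-tree rule).  lit-balaban TYPED SKELETON (HOME `run/shared/lean/pub/lit-balaban/`), Phase 2, seat p18
(gen 4), unit `lit-balaban-p18`: SKELETON row **B3.Eq2.2-2.3** (owner r15; decls of record `B3Sect2Statements.graphDegree`,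
`graphDegree_eq_22`), p. 423 [PDF 13], verbatim: *"D(G) = Σ_{v∈G} D_G(v) − d + (a sum of degrees of mass renormalization
counterterms connected with the vertices of the graph G). (2.3) Thus the degree of G is the same as the degree of a graph G′
obtained from G by attaching the corresponding graphs to the mass renormalization vertices."*

WHAT IS PROVED (sorry-free; theorems, one example datum).  For an attachment datum `A : AttachData G H` of
`B3AttachCounterterm` (a (1.7)-vertex v of G; the counterterm graph H = the graph G₀ of the counterterm, with its two external
undifferentiated φ′-legs x 0, x 1) and the attached graph G′ = `A.attach`:
* the incidence counts (2.1) of G′: an old vertex w ≠ v keeps its counts (`intScalar_inl`, `intVector_inl`, `intDiffs_inl`,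
  hence `vertexDeg_inl`: D_{G′}(w) = D_G(w)); a vertex u of H keeps its A′- and differentiation counts (`intVector_inr`,
  `intDiffs_inr`) and gains, as internal φ′-legs, exactly the attachment legs joined to lines of G (`sum_intScalar_inr`);
  D_G(v) = d + i_v (2 − d)/2 for the (1.7)-vertex with i_v internal legs (`vertexDeg_v`, (ii) p. 423: D(v₂) = 2);
* **`deg_attach`**: D(G′) computed by (2.2) = D(G) [(2.2), counterterm degree 0 at v] + D(H) — i.e. the printed sentence:
  **`graphDegree23_eq_deg_attach`**: r15's (2.3) `B3Sect2Statements.graphDegree` of G with the counterterm degree D(H) = D(G₀)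
  at v (and 0 elsewhere) EQUALS the (2.2)-degree of the attached graph G′;
* non-vacuity / the printed example (1.23)⑨ p. 417: hanging the counterterm graph of (1.22)④ (`B3Sect3LowestOrderGraphs.g36a`,
  D = 2 − d) at the (1.7)-vertex of (1.22)⑦ (`B3Sect1Graphs122.g122g`, D = 4 − d) is an attachment datum (`attach1239`) and the
  attached graph has degree 6 − 2d (`deg_attach1239`) = the degree of the attached picture `B3Sect1Graphs122.g123i`
  (`deg_attach1239_eq_g123i`).
SCOPE.  One mass renormalization vertex at a time (the general case iterates); the attachment legs carry no differentiation
(`AttachData.undiff` — true for the counterterm graphs of δm²₁, (1.23): the external legs of ①, ②, ④ are legs of (1.6), (1.10)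
and the undifferentiated legs of (1.8)); with a differentiated attachment leg joined to a line of G the (2.2)-count of G′ would
subtract that differentiation while (2.3) does not (reading note, HOME GAPS.md G-B3-10).
-/

namespace Literature.MathematicalPhysics.QuantumFieldTheory.Balaban1983to89.B3AttachCountertermDegree

open Finset B3Prop1 B3Sect2Statements B3VertexBridge B3Cor23Concrete B3OddVectorLoops B3IGraph B3AttachCounterterm
  B3Sect3LowestOrderGraphs B3Sect1Graphs122

variable {nbar : ℕ} {G H : Graph nbar} (A : AttachData G H)

/-! ## The incidence counts (2.1) of the attached graph at the old vertices -/

/-- kernel: the lines of G′ are `A.other'`. [cite: Balaban1983Higgs3, (2.3) p.423] -/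
theorem attach_other : A.attach.other = A.other' := rfl

/-- kernel: a φ′-leg of an old vertex lies on a line of G′ iff it lies on a line of G. [cite: Balaban1983Higgs3, (2.1) p.422] -/
theorem intScalar_inl (w : {w : Fin G.nV // w ≠ A.v}) : A.attach.intScalar (Sum.inl w) = G.intScalar w.1 := by
  show (univ.filter fun j : Fin (G.kind w.1).scalarLegs => (A.other' ⟨Sum.inl w, Sum.inl j⟩).isSome).card = _
  unfold Graph.intScalar
  exact congrArg card (filter_congr fun j _ => by rw [A.other'_inl, Option.isSome_map]; exact Iff.rfl)

/-- kernel: an A′-leg of an old vertex lies on a line of G′ iff it lies on a line of G. [cite: Balaban1983Higgs3, (2.1) p.422] -/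
theorem intVector_inl (w : {w : Fin G.nV // w ≠ A.v}) : A.attach.intVector (Sum.inl w) = G.intVector w.1 := by
  show (univ.filter fun j : Fin (G.kind w.1).vectorLegs => (A.other' ⟨Sum.inl w, Sum.inr j⟩).isSome).card = _
  unfold Graph.intVector
  exact congrArg card (filter_congr fun j _ => by rw [A.other'_inl, Option.isSome_map]; exact Iff.rfl)

/-- kernel: the differentiations of an old vertex act on lines of G′ iff they act on lines of G. [cite: Balaban1983Higgs3, (2.1) p.422] -/
theorem intDiffs_inl (w : {w : Fin G.nV // w ≠ A.v}) : A.attach.intDiffs (Sum.inl w) = G.intDiffs w.1 := by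
  show (if h : 0 < (G.kind w.1).scalarLegs then
      (if (A.other' ⟨Sum.inl w, Sum.inl ⟨0, h⟩⟩).isSome then (G.kind w.1).diffCount else 0) else 0) = _
  unfold Graph.intDiffs
  by_cases h : 0 < (G.kind w.1).scalarLegs
  · rw [dif_pos h, dif_pos h, A.other'_inl, Option.isSome_map]
    rfl
  · rw [dif_neg h, dif_neg h]

/-- kernel: D_{G′}(w) = D_G(w) for an old vertex w ≠ v. [cite: Balaban1983Higgs3, (2.1) p.422] -/
theorem vertexDeg_inl (d : ℕ) (w : {w : Fin G.nV // w ≠ A.v}) : A.attach.vertexDeg d (Sum.inl w) = G.vertexDeg d w.1 := by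
  rw [IGraph.vertexDeg_eq, Graph.vertexDeg_eq, intScalar_inl, intVector_inl, intDiffs_inl]
  rfl

/-! ## The incidence counts (2.1) of the attached graph at the vertices of the counterterm graph -/

/-- kernel: an A′-leg of H is not an attachment leg. [cite: Balaban1983Higgs3, (2.3) p.423] -/
theorem ne_xleg_inr (u : Fin H.nV) (j : Fin (H.kind u).vectorLegs) (k : Fin 2) : (⟨u, Sum.inr j⟩ : Leg H.kind) ≠ A.xleg k := by
  intro hk
  have := congrArg AttachData.toS hk
  rw [A.toS_xleg] at this
  simp [AttachData.toS] at this

/-- kernel: a φ′-leg of H other than x 0, x 1 is not an attachment leg. [cite: Balaban1983Higgs3, (2.3) p.423] -/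
theorem ne_xleg_inl (u : Fin H.nV) (j : Fin (H.kind u).scalarLegs) (h : ∀ k, A.x k ≠ ⟨u, j⟩) (k : Fin 2) :
    (⟨u, Sum.inl j⟩ : Leg H.kind) ≠ A.xleg k := by
  intro hk
  have := congrArg AttachData.toS hk
  rw [A.toS_xleg] at this
  exact h k (by simpa [AttachData.toS] using this.symm)

/-- kernel: an attachment leg lies on a line of G′ iff the corresponding leg of v lies on a line of G.
[cite: Balaban1983Higgs3, (2.3) p.423] -/
theorem isSome_other'_X (k : Fin 2) : (A.other' (A.X k)).isSome = (G.other (A.leg k)).isSome := by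
  rw [A.other'_X, Option.isSome_map]

/-- kernel: a φ′-leg of H other than the attachment legs lies on a line of G′ iff it lies on a line of H.
[cite: Balaban1983Higgs3, (2.3) p.423] -/
theorem isSome_other'_of_ne (u : Fin H.nV) (j : Fin (H.kind u).scalarLegs) (h : ∀ k, A.x k ≠ ⟨u, j⟩) :
    (A.other' ⟨Sum.inr u, Sum.inl j⟩).isSome = (H.other ⟨u, .inl j⟩).isSome := by
  have : A.other' ⟨Sum.inr u, Sum.inl j⟩ = (H.other ⟨u, .inl j⟩).map A.embH :=
    A.other'_embH (l := ⟨u, .inl j⟩) (ne_xleg_inl A u j h)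
  rw [this, Option.isSome_map]

/-- kernel: an A′-leg of a vertex of H lies on a line of G′ iff it lies on a line of H. [cite: Balaban1983Higgs3, (2.1) p.422] -/
theorem intVector_inr (u : Fin H.nV) : A.attach.intVector (Sum.inr u) = H.intVector u := by
  show (univ.filter fun j : Fin (H.kind u).vectorLegs => (A.other' ⟨Sum.inr u, Sum.inr j⟩).isSome).card = _
  unfold Graph.intVector
  refine congrArg card (filter_congr fun j _ => ?_)
  have : A.other' ⟨Sum.inr u, Sum.inr j⟩ = (H.other ⟨u, .inr j⟩).map A.embH :=
    A.other'_embH (l := ⟨u, .inr j⟩) (ne_xleg_inr A u j)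
  rw [this, Option.isSome_map]

/-- kernel: the differentiations of a vertex of H act on lines of G′ iff they act on lines of H (the attachment legs carry no
differentiation). [cite: Balaban1983Higgs3, (2.1) p.422] -/
theorem intDiffs_inr (u : Fin H.nV) : A.attach.intDiffs (Sum.inr u) = H.intDiffs u := by
  show (if h : 0 < (H.kind u).scalarLegs then
      (if (A.other' ⟨Sum.inr u, Sum.inl (⟨0, h⟩ : Fin (H.kind u).scalarLegs)⟩).isSome then (H.kind u).diffCount else 0)
      else 0) = _
  unfold Graph.intDiffs
  by_cases h : 0 < (H.kind u).scalarLegs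
  · rw [dif_pos h, dif_pos h]
    by_cases hx : ∃ k, A.x k = ⟨u, ⟨0, h⟩⟩
    · obtain ⟨k, hk⟩ := hx
      have h1 : (A.x k).1 = u := by rw [hk]
      have h2 : ((A.x k).2 : ℕ) = 0 := by rw [hk]
      have h0 : (H.kind u).diffCount = 0 := by
        have := A.undiff k h2
        rwa [h1] at this
      simp [h0]
    · rw [isSome_other'_of_ne A u ⟨0, h⟩ fun k hk => hx ⟨k, hk⟩]
  · rw [dif_neg h, dif_neg h]

/-- kernel: D_{G′}(u) for a vertex u of H differs from D_H(u) only through the newly internal φ′-legs.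
[cite: Balaban1983Higgs3, (2.1) p.422] -/
theorem vertexDeg_inr (d : ℕ) (u : Fin H.nV) :
    A.attach.vertexDeg d (Sum.inr u) =
      H.vertexDeg d u + ((A.attach.intScalar (Sum.inr u) : ℚ) - H.intScalar u) * ((2 - (d : ℚ)) / 2) := by
  rw [IGraph.vertexDeg_eq, Graph.vertexDeg_eq, intVector_inr, intDiffs_inr]
  have hk : A.attach.kind (Sum.inr u) = H.kind u := rfl
  rw [hk]
  push_cast
  ring

/-- kernel: the φ′-legs of H lying on lines of G′ are those lying on lines of H together with the attachment legs x k whose leg k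
of v lies on a line of G. [cite: Balaban1983Higgs3, (2.3) p.423] -/
theorem sum_intScalar_inr :
    ∑ u, A.attach.intScalar (Sum.inr u) =
      ∑ u, H.intScalar u + (univ.filter fun k : Fin 2 => (G.other (A.leg k)).isSome).card := by
  classical
  have hL : ∑ u, A.attach.intScalar (Sum.inr u) =
      (univ.filter fun y : SLeg H => (A.other' ⟨Sum.inr y.1, Sum.inl y.2⟩).isSome).card := by
    rw [card_filter, Fintype.sum_sigma]
    refine sum_congr rfl fun u _ => ?_
    show (univ.filter fun j : Fin (H.kind u).scalarLegs => (A.other' ⟨Sum.inr u, Sum.inl j⟩).isSome).card = _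
    rw [card_filter]
  have hR : ∑ u, H.intScalar u = (univ.filter fun y : SLeg H => (H.other ⟨y.1, .inl y.2⟩).isSome).card := by
    rw [card_filter, Fintype.sum_sigma]
    refine sum_congr rfl fun u _ => ?_
    unfold Graph.intScalar
    rw [card_filter]
  rw [hL, hR, ← card_filter_add_card_filter_not (s := univ.filter fun y : SLeg H =>
      (A.other' ⟨Sum.inr y.1, Sum.inl y.2⟩).isSome) (fun y : SLeg H => ∃ k, A.x k = y), add_comm]
  congr 1
  · -- the φ′-legs of H other than the attachment legs
    congr 1
    ext ⟨u, j⟩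
    simp only [mem_filter, mem_univ, true_and, not_exists]
    constructor
    · rintro ⟨h1, h2⟩
      rwa [isSome_other'_of_ne A u j h2] at h1
    · intro h1
      have h2 : ∀ k, A.x k ≠ ⟨u, j⟩ := by
        intro k hk
        have hext := A.ext k
        rw [hk] at hext
        rw [hext] at h1
        simp at h1
      exact ⟨by rwa [isSome_other'_of_ne A u j h2], h2⟩
  · -- the attachment legs
    rw [← card_image_of_injective (univ.filter fun k : Fin 2 => (G.other (A.leg k)).isSome) A.x_inj]
    congr 1
    ext y
    simp only [mem_filter, mem_univ, true_and, mem_image]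
    constructor
    · rintro ⟨h1, k, rfl⟩
      exact ⟨k, by rwa [show (⟨Sum.inr (A.x k).1, Sum.inl (A.x k).2⟩ : ILeg A.kind') = A.X k from rfl,
        isSome_other'_X A] at h1, rfl⟩
    · rintro ⟨k, hk, rfl⟩
      refine ⟨?_, k, rfl⟩
      rw [show (⟨Sum.inr (A.x k).1, Sum.inl (A.x k).2⟩ : ILeg A.kind') = A.X k from rfl, isSome_other'_X A]
      exact hk

/-! ## The mass renormalization vertex -/

/-- kernel: the internal φ′-legs of v, counted over its two legs. [cite: Balaban1983Higgs3, (1.7) p.413] -/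
theorem intScalar_v : G.intScalar A.v = (univ.filter fun k : Fin 2 => (G.other (A.leg k)).isSome).card := by
  unfold Graph.intScalar
  rw [card_filter, card_filter]
  exact (Fintype.sum_equiv (finCongr A.two_eq) _ _ fun k => rfl).symm

/-- kernel, (ii) p. 423 for the vertex (1.7) inside G: D_G(v) = d + i_v (2 − d)/2, i_v the number of its legs on lines of G
(D(v₂) = 2 when both are). [cite: Balaban1983Higgs3, (2.1) p.422] -/
theorem vertexDeg_v (d : ℕ) :
    G.vertexDeg d A.v =
      (d : ℚ) + ((univ.filter fun k : Fin 2 => (G.other (A.leg k)).isSome).card : ℚ) * ((2 - (d : ℚ)) / 2) := by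
  rw [Graph.vertexDeg_eq, ← intScalar_v]
  have h1 : (G.kind A.v).etaCount d = d := by rw [A.hv]; rfl
  have h2 : (G.kind A.v).isAveragingVertex = false := by rw [A.hv]; rfl
  have h3 : G.intVector A.v = 0 := by have := G.intVector_le A.v; rw [A.vec_eq] at this; omega
  have h4 : G.intDiffs A.v = 0 := by
    have h5 : (G.kind A.v).diffCount = 0 := by rw [A.hv]; rfl
    have := G.intDiffs_le A.v; rw [h5] at this; omega
  rw [h1, h3, h4]
  simp [h2]

/-- kernel: a sum over the vertices of G splits into the vertices other than v and v. [cite: Balaban1983Higgs3, (2.2) p.423] -/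
theorem sum_subtype_ne_add (f : Fin G.nV → ℚ) : (∑ w : {w : Fin G.nV // w ≠ A.v}, f w.1) + f A.v = ∑ i, f i := by
  rw [← Finset.sum_subtype (univ.erase A.v) (p := fun w => w ≠ A.v) (fun w => by simp) f]
  exact Finset.sum_erase_add _ _ (mem_univ _)

/-! ## The sentence after (2.3) -/

/-- **p. 423** [PDF 13], the sentence after (2.3) — *"Thus the degree of G is the same as the degree of a graph G′ obtained from G
by attaching the corresponding graphs to the mass renormalization vertices"* — for one mass renormalization vertex, on the
model: the (2.2)-degree of the attached graph G′ = `A.attach` is D(G) [the model's `Graph.deg`: (2.2) with counterterm degree 0 at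
v] + D(H), H = the graph G₀ of the counterterm. [cite: Balaban1983Higgs3, (2.3) p.423] -/
theorem deg_attach (d : ℕ) : A.attach.deg d = G.deg d + H.deg d := by
  have hS : ∑ w : {w : Fin G.nV // w ≠ A.v}, A.attach.vertexDeg d (Sum.inl w) =
      ∑ w : {w : Fin G.nV // w ≠ A.v}, G.vertexDeg d w.1 := sum_congr rfl fun w _ => vertexDeg_inl A d w
  have hH : ∑ u, A.attach.vertexDeg d (Sum.inr u) =
      ∑ u, H.vertexDeg d u + ((univ.filter fun k : Fin 2 => (G.other (A.leg k)).isSome).card : ℚ) * ((2 - (d : ℚ)) / 2) := by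
    rw [sum_congr rfl fun u _ => vertexDeg_inr A d u, sum_add_distrib, ← sum_mul, sum_sub_distrib]
    have := congrArg (fun n : ℕ => (n : ℚ)) (sum_intScalar_inr A)
    push_cast at this
    rw [this]
    ring
  unfold IGraph.deg
  rw [Fintype.sum_sum_type, hS, hH, G.deg_eq, H.deg_eq, ← sum_subtype_ne_add A (G.vertexDeg d), vertexDeg_v]
  ring

/-- **(2.3) ⇔ (2.2) of G′**, p. 423: r15's (2.3) `B3Sect2Statements.graphDegree` of G — D(G) = Σ_v D_G(v) − d + (the degree D(H) =
D(G₀) of the mass renormalization counterterm at v, 0 at the other vertices) — EQUALS the (2.2)-degree of the attached graph G′.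
[cite: Balaban1983Higgs3, (2.3) p.423] -/
theorem graphDegree23_eq_deg_attach (d : ℕ) :
    graphDegree d univ
        (fun i => (⟨toCounts d (G.kind i), G.incidence d i, if i = A.v then H.deg d else 0⟩ : GraphVertex)) =
      A.attach.deg d := by
  rw [deg_attach, graphDegree, G.deg_eq]
  simp only [sum_ite_eq', mem_univ, if_true]
  rfl

/-! ## The printed example (1.23)⑨ -/

/-- The attachment datum of (1.23)⑨ p. 417: the counterterm graph of (1.22)④ (`g36a`: two vertices (1.8)_{1,0}, its external
legs the undifferentiated φ′-legs) hung at the (1.7)-vertex x″ of (1.22)⑦ (`g122g`). [cite: Balaban1983Higgs3, (1.23) p.417] -/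
def attach1239 (hn : 1 ≤ nbar) : AttachData (g122g nbar hn) (g36a nbar hn) where
  v := ⟨2, by show 2 < 3; omega⟩
  hv := rfl
  x k := ⟨k, ⟨1, by show 1 < 2; omega⟩⟩
  x_inj a b h := Fin.ext (by simpa using congrArg (fun y : SLeg (g36a nbar hn) => (y.1 : ℕ)) h)
  ext k := by fin_cases k <;> rfl
  undiff _ h := absurd h Nat.one_ne_zero

/-- (1.23)⑨: the attached graph has degree (4 − d) + (2 − d) = 6 − 2d (`g122g_deg`, `g36a_deg`). [cite: Balaban1983Higgs3, (1.23) p.417] -/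
theorem deg_attach1239 (d : ℕ) (hn : 1 ≤ nbar) : (attach1239 hn).attach.deg d = 6 - 2 * (d : ℚ) := by
  rw [deg_attach, g122g_deg, g36a_deg]; ring

/-- (1.23)⑨: … which is the degree of the attached picture `g123i` typed in `B3Sect1Graphs122` (`g123i_deg`).
[cite: Balaban1983Higgs3, (1.23) p.417] -/
theorem deg_attach1239_eq_g123i (d : ℕ) (hn : 1 ≤ nbar) : (attach1239 hn).attach.deg d = (g123i nbar hn).deg d := by
  rw [deg_attach1239, g123i_deg]

end Literature.MathematicalPhysics.QuantumFieldTheory.Balaban1983to89.B3AttachCountertermDegree
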